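import Mathlib
import Summits.AtomisticToContinuum.BoseEinsteinCondensation.Theses.BECInfDivCoherence
import Summits.AtomisticToContinuum.BoseEinsteinCondensation.Theses.BECGroundStateSOS
import Summits.AtomisticToContinuum.BoseEinsteinCondensation.Theorems.BECGroundStateSOSIRModeCounting
import Summits.AtomisticToContinuum.BoseEinsteinCondensation.Theorems.BECGroundStateSOSPeriodicEnergyFinite

/-!
# Strategy census for crux `LevyNegativeMoment` (stmt-AtomisticToContinuum-9115) — typed signatures

Planner crux-strategist `cstrat-stmt-AtomisticToContinuum-9115-s1`, 2026-08-17.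
This file only TYPES the statements discussed in `STRATEGY-CENSUS.md` (no proofs are claimed;
every `def` is a `Prop`).  It elaborates against the two route files it imports.

* `LevyNegativeMomentRho`  — the crux with `C` chosen AFTER `ρ` (what the glue `LevyMassCondensation`
  actually consumes, up to `C(ρ) = O(ρ^{-1/2})`, see the census §0).
* `LevyPointwiseIRBound`    — STRENGTHEN candidate S⁺: two-regime pointwise infrared bound on the positive
  grid Lévy weights (Gaussian-domination shape `√ρ/|k|` below `√ρ`, Bogoliubov tail `ρ^{1+s/2}/|k|^{2+s}` above).
* `MidWindowTail`           — DECOMPOSITION piece Sub₂: pointwise occupation bound beyond the Goldstone window.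
* `LogTransfer`             — DECOMPOSITION piece Sub₃ (bridge form): PeriodicIRBound → MidWindowTail → crux.
* `levyNegativeMoment_of_subs` — the (trivial-seam) assembly of the split, kernel-checked.
-/

namespace Summit.AtomisticToContinuum.BoseEinsteinCondensation.Cruxes.LevyNegativeMoment.Strategist

open scoped BigOperators ComplexConjugate
open Filter MeasureTheory
open Literature.MathematicalPhysics.QuantumManyBody.BoseGas

/-- The crux with the constant chosen after the density: `∀ ρ < ρ₀, ∃ C, ∀ᶠ N, …` (everything else verbatim). -/
def LevyNegativeMomentRho : Prop :=
  ∀ v : ℝ → ENNReal, IsRepulsiveFiniteRange v → ∀ η : ℝ, 0 < η → ∃ ρ₀ : ℝ, 0 < ρ₀ ∧ ∀ ρ : ℝ, 0 < ρ → ρ < ρ₀ → ∃ C : ℝ, ∀ᶠ N : ℕ in Filter.atTop, ∃ δ : ENNReal, 0 < δ ∧ ∀ Ψ : PeriodicTrialState N (sideLength ρ N), periodicEnergy v Ψ ≤ periodicGroundStateEnergy v N (sideLength ρ N) + δ → ∀ i : Fin N, let L : ℝ := sideLength ρ N; let m : ℕ := ⌊L / η⌋₊; let G : EuclideanSpace ℝ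 (Fin 3) → ℝ := fun r => (∫ X in cellN N L, conj (Ψ.ψ (Function.update X i (X i + r))) * Ψ.ψ X).re; let ν : (Fin 3 → Fin m) → ℝ := fun q => (∑ j : Fin 3 → Fin m, Real.log (G (latticeVec (L / m) (fun k => ((j k : ℕ) : ℤ)))) * Real.cos (2 * Real.pi * (∑ k, ((q k : ℕ) : ℝ) * ((j k : ℕ) : ℝ)) / m)) / (m : ℝ) ^ 3; (∑ q : Fin 3 → Fin m with (∃ k, (q k : ℕ) ≠ 0), max (ν q) 0 / (2 * Real.pi / L * Real.sqrt (∑ k, ((min (q k : ℕ) (m - (q k : ℕ)) : ℕ) : ℝ) ^ 2))) ≤ C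

/-- STRENGTHEN candidate S⁺: two-regime POINTWISE infrared bound on the positive Lévy weights,
`max(ν̃_q,0) ≤ (C/N)·√ρ/(|k_q|·(1+|k_q|²/ρ)^{(1+s)/2})` for some `s > 0`, uniformly in `N` and `ρ < ρ₀`.
Summing against `1/|k_q|` gives the crux with `C' = C·B(s)/(2π²)` (ρ-uniform). -/
def LevyPointwiseIRBound : Prop :=
  ∀ v : ℝ → ENNReal, IsRepulsiveFiniteRange v → ∀ η : ℝ, 0 < η → ∃ s : ℝ, 0 < s ∧ ∃ C : ℝ, ∃ ρ₀ : ℝ, 0 < ρ₀ ∧ ∀ ρ : ℝ, 0 < ρ → ρ < ρ₀ → ∀ᶠ N : ℕ in Filter.atTop, ∃ δ : ENNReal, 0 < δ ∧ ∀ Ψ : PeriodicTrialState N (sideLength ρ N), periodicEnergy v Ψ ≤ periodicGroundStateEnergy v N (sideLength ρ N) + δ → ∀ i : Fin N, let L : ℝ := sideLength ρ N; let m : ℕ := ⌊L / η⌋₊; let G : EuclideanSpace ℝ (Fin 3) → ℝ := fun r => (∫ X in cellN N L, conj (Ψ.ψ (Function.update X i (X i + r))) * Ψ.ψ X).re; let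 ν : (Fin 3 → Fin m) → ℝ := fun q => (∑ j : Fin 3 → Fin m, Real.log (G (latticeVec (L / m) (fun k => ((j k : ℕ) : ℤ)))) * Real.cos (2 * Real.pi * (∑ k, ((q k : ℕ) : ℝ) * ((j k : ℕ) : ℝ)) / m)) / (m : ℝ) ^ 3; ∀ q : Fin 3 → Fin m, (∃ k, (q k : ℕ) ≠ 0) → let kq : ℝ := 2 * Real.pi / L * Real.sqrt (∑ k, ((min (q k : ℕ) (m - (q k : ℕ)) : ℕ) : ℝ) ^ 2); max (ν q) 0 ≤ C / N * (Real.sqrt ρ / (kq * (1 + kq ^ 2 / ρ) ^ ((1 + s) / 2)))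

/-- DECOMPOSITION piece Sub₂ (`MidWindowTail`): beyond the Goldstone window `‖k‖ ≥ κ√ρ·L` the plane-wave
occupations of near-minimisers obey a Bogoliubov-type tail `n_k ≤ C ρ^{1+s/2} (L/(2π‖k‖))^{2+s}` for some
`s > 0`, uniformly in `N` and `ρ < ρ₀` (Bogoliubov: `s = 2`, `C ≍ a²`).  Short of the summit: compatible with
generalized (non-macroscopic) condensation inside the window. -/
def MidWindowTail : Prop :=
  ∀ v : ℝ → ENNReal, IsRepulsiveFiniteRange v → ∀ κ : ℝ, 0 < κ → ∃ s : ℝ, 0 < s ∧ ∃ ρ₀ : ℝ, 0 < ρ₀ ∧ ∃ C : ℝ, 0 < C ∧ ∀ ρ : ℝ, 0 < ρ → ρ < ρ₀ → ∀ᶠ N : ℕ in Filter.atTop, ∃ δ : ENNReal, 0 < δ ∧ ∀ Ψ : PeriodicTrialState N (sideLength ρ N), periodicEnergy v Ψ ≤ periodicGroundStateEnergy v N (sideLength ρ N) + δ → ∀ k : Fin 3 → ℤ, k ≠ 0 → κ * Real.sqrt ρ * sideLength ρ N ≤ ‖(fun j => (k j : ℝ))‖ → cellOccupation N (sideLength ρ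 N) (fun x => ((Real.sqrt (sideLength ρ N ^ 3))⁻¹ : ℂ) * cellWave (sideLength ρ N) k x) Ψ.ψ ≤ ENNReal.ofReal (C * ρ ^ (1 + s / 2) * (sideLength ρ N / (2 * Real.pi * ‖(fun j => (k j : ℝ))‖)) ^ (2 + s))

/-- DECOMPOSITION piece Sub₃ (`LogTransfer`, bridge form): the pointwise infrared data (Goldstone window:
`PeriodicIRBound` of route BECGroundStateSOS, stmt-3972; beyond: `MidWindowTail`) transfer to the (−1)-moment
of the positive grid Lévy weights of `log G` (aliasing `n_k ↦ Ĝ`, kinetic UV tail from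
`LSSY2005_upperBound_periodic_holds`, `log(1+t)` odd/even series with `t̂ ≥ 0`, discrete HLS for the bilinear terms). -/
def LogTransfer : Prop :=
  Summit.AtomisticToContinuum.BoseEinsteinCondensation.Theses.BECGroundStateSOS.PeriodicIRBound →
    MidWindowTail → Summit.AtomisticToContinuum.BoseEinsteinCondensation.Theses.BECInfDivCoherence.LevyNegativeMoment

/-- The split's assembly (trivial seam, by design: all content sits in the three pieces). -/
theorem levyNegativeMoment_of_subs :
    Summit.AtomisticToContinuum.BoseEinsteinCondensation.Theses.BECGroundStateSOS.PeriodicIRBound →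
    MidWindowTail → LogTransfer →
    Summit.AtomisticToContinuum.BoseEinsteinCondensation.Theses.BECInfDivCoherence.LevyNegativeMoment :=
  fun h1 h2 h3 => h3 h1 h2

/-- The crux as typed implies the `C`-after-`ρ` form (pure logic). -/
theorem levyNegativeMomentRho_of_crux
    (h : Summit.AtomisticToContinuum.BoseEinsteinCondensation.Theses.BECInfDivCoherence.LevyNegativeMoment) :
    LevyNegativeMomentRho := by
  intro v hv η hη
  obtain ⟨C, ρ₀, hρ₀, hC⟩ := h v hv η hη
  exact ⟨ρ₀, hρ₀, fun ρ hρ hρ' => ⟨C, hC ρ hρ hρ'⟩⟩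

/-- Piece Sub₁ alone is already the route target: `PeriodicIRBound` gives the PeriodicBEC clause through the
PROVED supports of route BECGroundStateSOS (finiteness stmt-3974, mode counting stmt-4246). -/
theorem periodicBEC_of_periodicIRBound
    (hX : Summit.AtomisticToContinuum.BoseEinsteinCondensation.Theses.BECGroundStateSOS.PeriodicIRBound) :
    ∀ v : ℝ → ENNReal, IsRepulsiveFiniteRange v → ∃ ρ₀ : ℝ, 0 < ρ₀ ∧ ∀ ρ : ℝ, 0 < ρ → ρ < ρ₀ → ∃ c : ℝ, 0 < c ∧ ∀ᶠ N : ℕ in Filter.atTop, ∃ δ : ENNReal, 0 < δ ∧ ∀ Ψ : PeriodicTrialState N (sideLength ρ N), periodicEnergy v Ψ ≤ periodicGroundStateEnergy v N (sideLength ρ N) + δ → ENNReal.ofReal (c * N) ≤ condensateOccupation N (sideLength ρ N) Ψ.ψ :=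
  Summit.AtomisticToContinuum.BoseEinsteinCondensation.Theorems.IRModeCounting_proof
    Summit.AtomisticToContinuum.BoseEinsteinCondensation.Theorems.periodicEnergyFinite_proof hX

end Summit.AtomisticToContinuum.BoseEinsteinCondensation.Cruxes.LevyNegativeMoment.Strategist
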